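import Mathlib
import Summits.ValiantsHypothesis.ValiantsHypothesis.Theorems.NewtonUnitEquationsNewtonTauWeakCornerDefs

/-!
# `NewtonTauWeak` (stmt-ValiantsHypothesis-5904), line `binomial-normal-form`: initial exponents of Laurent
# polynomials in two variables (toolkit for the `K = 3` coincidence rung `fixedKCoincidence_t2_K3`)

Support file for the crux
`Summit.ValiantsHypothesis.ValiantsHypothesis.Theses.NewtonUnitEquations.NewtonTauWeak`.
We work in the group algebra `L = ℂ[ℤ²]` (`AddMonoidAlgebra ℂ (Fin 2 → ℤ)`, Laurent polynomials in two
variables) with a real weight `w` (`wt w z = w₀ z₀ + w₁ z₁`, from `…CornerDefs`).  For `a ∈ L`, an exponent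
`z` is `w`-INITIAL if it lies in the support of `a` and has least weight; when `wt w` is injective on `ℤ²`
(generic `w`) it is unique.  This file proves the calculus of initial exponents (predicate style, no new
definitions): existence/uniqueness, monomials, products (`init_mul`, `init_prod`: initial exponents add,
initial coefficients multiply), sums (`init_add_of_lt`, `init_add_of_eq`, `init_sum`), and univariate
polynomials pushed along a direction `E` of positive weight (`Polynomial.aeval (single E 1) U`: initial
exponent `ord(U) • E`, `init_aeval_single`).  Everything is [folklore] (term orders on group algebras).
-/

set_option linter.dupNamespace false

noncomputable section

open scoped BigOperators Polynomial
open Summit.ValiantsHypothesis.ValiantsHypothesis.Theorems.NewtonTauWeakCorner (wt wt_add wt_zsmul wt_zero)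

namespace Summit.ValiantsHypothesis.ValiantsHypothesis.Theorems.NewtonUnitEquationsNewtonTauWeak.FixedK3

variable {w : Fin 2 → ℝ}

/-! ## Existence and uniqueness of initial exponents -/

/-- A nonzero Laurent polynomial has a `w`-initial exponent. [folklore] -/
theorem exists_init (w : Fin 2 → ℝ) {a : AddMonoidAlgebra ℂ (Fin 2 → ℤ)} (ha : a ≠ 0) :
    ∃ z ∈ a.coeff.support, ∀ z' ∈ a.coeff.support, wt w z ≤ wt w z' :=
  Finset.exists_min_image _ (wt w)
    (Finsupp.support_nonempty_iff.mpr (by rwa [Ne, AddMonoidAlgebra.coeff_eq_zero]))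

/-- For an injective weight the initial exponent is unique. [folklore] -/
theorem init_unique (hw : Function.Injective (wt w)) {a : AddMonoidAlgebra ℂ (Fin 2 → ℤ)}
    {z z' : Fin 2 → ℤ} (hz : z ∈ a.coeff.support) (hmin : ∀ x ∈ a.coeff.support, wt w z ≤ wt w x)
    (hz' : z' ∈ a.coeff.support) (hmin' : ∀ x ∈ a.coeff.support, wt w z' ≤ wt w x) : z = z' :=
  hw (le_antisymm (hmin z' hz') (hmin' z hz))

/-- An element with an initial exponent is nonzero. [folklore] -/
theorem ne_zero_of_mem_support {a : AddMonoidAlgebra ℂ (Fin 2 → ℤ)} {z : Fin 2 → ℤ}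
    (hz : z ∈ a.coeff.support) : a ≠ 0 := by
  rintro rfl
  simp at hz

/-- Weight of a natural multiple. [folklore] -/
theorem wt_nsmul (w : Fin 2 → ℝ) (k : ℕ) (z : Fin 2 → ℤ) : wt w (k • z) = (k : ℝ) * wt w z := by
  rw [← natCast_zsmul, wt_zsmul]; simp

/-- Weight of a negation. [folklore] -/
theorem wt_neg (w : Fin 2 → ℝ) (z : Fin 2 → ℤ) : wt w (-z) = - wt w z := by
  rw [← neg_one_zsmul, wt_zsmul]; simp

/-- An injective weight does not vanish on nonzero vectors. [folklore] -/
theorem wt_ne_zero (hw : Function.Injective (wt w)) {z : Fin 2 → ℤ} (hz : z ≠ 0) : wt w z ≠ 0 := by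
  rw [← wt_zero w]; exact fun h => hz (hw h)

/-! ## Monomials -/

/-- The monomial `c X^z` (`c ≠ 0`) has initial exponent `z`. [folklore] -/
theorem init_single (w : Fin 2 → ℝ) (z : Fin 2 → ℤ) {c : ℂ} (hc : c ≠ 0) :
    z ∈ (AddMonoidAlgebra.single z c : AddMonoidAlgebra ℂ (Fin 2 → ℤ)).coeff.support ∧
      ∀ x ∈ (AddMonoidAlgebra.single z c : AddMonoidAlgebra ℂ (Fin 2 → ℤ)).coeff.support,
        wt w z ≤ wt w x := by
  simp [AddMonoidAlgebra.coeff_single, Finsupp.support_single, hc]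

/-! ## Products -/

/-- **Initial exponents add under multiplication** (injective weight), and the initial coefficient of the
product is the product of the initial coefficients. [folklore] -/
theorem init_mul (hw : Function.Injective (wt w)) {a b : AddMonoidAlgebra ℂ (Fin 2 → ℤ)} {x y : Fin 2 → ℤ}
    (hx : x ∈ a.coeff.support) (hxmin : ∀ z ∈ a.coeff.support, wt w x ≤ wt w z)
    (hy : y ∈ b.coeff.support) (hymin : ∀ z ∈ b.coeff.support, wt w y ≤ wt w z) :
    (a * b).coeff (x + y) = a.coeff x * b.coeff y ∧ (x + y) ∈ (a * b).coeff.support ∧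
      ∀ z ∈ (a * b).coeff.support, wt w (x + y) ≤ wt w z := by
  classical
  have hcoef : (a * b).coeff (x + y) = a.coeff x * b.coeff y := by
    rw [AddMonoidAlgebra.coeff_mul]
    simp only [Finsupp.sum]
    rw [Finset.sum_eq_single_of_mem x hx]
    · rw [Finset.sum_eq_single_of_mem y hy]
      · rw [if_pos rfl]
      · intro m₂ _ hne
        rw [if_neg]
        intro h
        exact hne (add_left_cancel h)
    · intro m₁ hm₁ hne
      refine Finset.sum_eq_zero fun m₂ hm₂ => ?_
      rw [if_neg]
      intro h
      have h1 := hxmin m₁ hm₁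
      have h2 := hymin m₂ hm₂
      have h3 : wt w m₁ + wt w m₂ = wt w x + wt w y := by rw [← wt_add, ← wt_add, h]
      have h4 : wt w m₁ = wt w x := by linarith
      exact hne (hw h4)
  have hne : (a * b).coeff (x + y) ≠ 0 := by
    rw [hcoef]
    exact mul_ne_zero (Finsupp.mem_support_iff.mp hx) (Finsupp.mem_support_iff.mp hy)
  refine ⟨hcoef, Finsupp.mem_support_iff.mpr hne, fun z hz => ?_⟩
  obtain ⟨m₁, hm₁, m₂, hm₂, rfl⟩ := Finset.mem_add.mp (AddMonoidAlgebra.support_coeff_mul_subset a b hz)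
  rw [wt_add, wt_add]
  exact add_le_add (hxmin m₁ hm₁) (hymin m₂ hm₂)

/-- **Initial exponent of a finite product**: the sum of the initial exponents, with coefficient the
product of the initial coefficients. [folklore] -/
theorem init_prod (hw : Function.Injective (wt w)) {ι : Type*} [DecidableEq ι] (s : Finset ι)
    (f : ι → AddMonoidAlgebra ℂ (Fin 2 → ℤ)) (x : ι → Fin 2 → ℤ)
    (h : ∀ i ∈ s, x i ∈ (f i).coeff.support ∧ ∀ z ∈ (f i).coeff.support, wt w (x i) ≤ wt w z) :
    (∏ i ∈ s, f i).coeff (∑ i ∈ s, x i) = ∏ i ∈ s, (f i).coeff (x i) ∧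
      (∑ i ∈ s, x i) ∈ (∏ i ∈ s, f i).coeff.support ∧
      ∀ z ∈ (∏ i ∈ s, f i).coeff.support, wt w (∑ i ∈ s, x i) ≤ wt w z := by
  induction s using Finset.induction_on with
  | empty =>
    simp only [Finset.prod_empty, Finset.sum_empty, AddMonoidAlgebra.one_def,
      AddMonoidAlgebra.coeff_single, Finsupp.single_eq_same, true_and]
    simp [Finsupp.support_single]
  | insert a s ha ih =>
    have h' := ih fun i hi => h i (Finset.mem_insert_of_mem hi)
    have ha' := h a (Finset.mem_insert_self a s)
    rw [Finset.prod_insert ha, Finset.sum_insert ha]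
    obtain ⟨hc, hm, hmin⟩ := init_mul hw ha'.1 ha'.2 h'.2.1 h'.2.2
    refine ⟨?_, hm, hmin⟩
    rw [hc, h'.1, Finset.prod_insert ha]

/-! ## Sums -/

/-- **Sum with a strictly heavier perturbation**: if every exponent of `b` is strictly heavier than the
initial exponent `x` of `a`, then `x` is the initial exponent of `a + b` with the same coefficient.
[folklore] -/
theorem init_add_of_lt {a b : AddMonoidAlgebra ℂ (Fin 2 → ℤ)} {x : Fin 2 → ℤ}
    (hx : x ∈ a.coeff.support) (hxmin : ∀ z ∈ a.coeff.support, wt w x ≤ wt w z)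
    (hb : ∀ z ∈ b.coeff.support, wt w x < wt w z) :
    (a + b).coeff x = a.coeff x ∧ x ∈ (a + b).coeff.support ∧
      ∀ z ∈ (a + b).coeff.support, wt w x ≤ wt w z := by
  have hbx : b.coeff x = 0 := by
    by_contra h
    exact lt_irrefl _ (hb x (Finsupp.mem_support_iff.mpr h))
  have hcoef : (a + b).coeff x = a.coeff x := by
    rw [AddMonoidAlgebra.coeff_add, Finsupp.add_apply, hbx, add_zero]
  refine ⟨hcoef, ?_, fun z hz => ?_⟩
  · rw [Finsupp.mem_support_iff, hcoef]
    exact Finsupp.mem_support_iff.mp hx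
  · rw [AddMonoidAlgebra.coeff_add] at hz
    rcases Finset.mem_union.mp (Finsupp.support_add hz) with h | h
    · exact hxmin z h
    · exact (hb z h).le

/-- **Sum without cancellation at a common lightest exponent**: if `x` is initial for `a`, no exponent of
`b` is lighter than `x`, and the coefficients at `x` do not cancel, then `x` is initial for `a + b`.
[folklore] -/
theorem init_add_of_eq {a b : AddMonoidAlgebra ℂ (Fin 2 → ℤ)} {x : Fin 2 → ℤ}
    (hxmin : ∀ z ∈ a.coeff.support, wt w x ≤ wt w z) (hbmin : ∀ z ∈ b.coeff.support, wt w x ≤ wt w z)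
    (hc : a.coeff x + b.coeff x ≠ 0) :
    (a + b).coeff x = a.coeff x + b.coeff x ∧ x ∈ (a + b).coeff.support ∧
      ∀ z ∈ (a + b).coeff.support, wt w x ≤ wt w z := by
  have hcoef : (a + b).coeff x = a.coeff x + b.coeff x := by
    rw [AddMonoidAlgebra.coeff_add, Finsupp.add_apply]
  refine ⟨hcoef, ?_, fun z hz => ?_⟩
  · rw [Finsupp.mem_support_iff, hcoef]
    exact hc
  · rw [AddMonoidAlgebra.coeff_add] at hz
    rcases Finset.mem_union.mp (Finsupp.support_add hz) with h | h
    · exact hxmin z h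
    · exact hbmin z h

/-- Support of a negation. [folklore] -/
theorem support_neg (a : AddMonoidAlgebra ℂ (Fin 2 → ℤ)) : (-a).coeff.support = a.coeff.support := by
  rw [AddMonoidAlgebra.coeff_neg, Finsupp.support_neg]

/-- Support of a nonzero scalar multiple. [folklore] -/
theorem support_smul (a : AddMonoidAlgebra ℂ (Fin 2 → ℤ)) {c : ℂ} (hc : c ≠ 0) :
    (c • a).coeff.support = a.coeff.support := by
  rw [AddMonoidAlgebra.coeff_smul, Finsupp.support_smul_eq hc]

/-- Support of a finite sum. [folklore] -/
theorem support_sum_subset {ι : Type*} [DecidableEq ι] (s : Finset ι)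
    (f : ι → AddMonoidAlgebra ℂ (Fin 2 → ℤ)) :
    (∑ i ∈ s, f i).coeff.support ⊆ s.biUnion fun i => (f i).coeff.support := by
  rw [AddMonoidAlgebra.coeff_sum]
  exact Finsupp.support_finsetSum

/-- **Initial exponent of a finite sum with a strictly lightest term**: if the term `f i` has initial
exponent `x` and every exponent of every other term is strictly heavier, then `x` is initial for the sum,
with the coefficient of `f i`. [folklore] -/
theorem init_sum {ι : Type*} [DecidableEq ι] (s : Finset ι) (f : ι → AddMonoidAlgebra ℂ (Fin 2 → ℤ))
    {i : ι} (hi : i ∈ s) {x : Fin 2 → ℤ}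
    (hx : x ∈ (f i).coeff.support) (hxmin : ∀ z ∈ (f i).coeff.support, wt w x ≤ wt w z)
    (hother : ∀ j ∈ s, j ≠ i → ∀ z ∈ (f j).coeff.support, wt w x < wt w z) :
    (∑ j ∈ s, f j).coeff x = (f i).coeff x ∧ x ∈ (∑ j ∈ s, f j).coeff.support ∧
      ∀ z ∈ (∑ j ∈ s, f j).coeff.support, wt w x ≤ wt w z := by
  rw [← Finset.add_sum_erase s f hi]
  refine init_add_of_lt hx hxmin fun z hz => ?_
  obtain ⟨j, hj, hz⟩ := Finset.mem_biUnion.mp (support_sum_subset _ _ hz)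
  exact hother j (Finset.mem_of_mem_erase hj) (Finset.ne_of_mem_erase hj) z hz

/-! ## Univariate polynomials pushed along a direction -/

/-- Expansion of `U(X^E)` as a sum of monomials `[t^k]U · X^{k E}`. [folklore] -/
theorem aeval_single_eq_sum (E : Fin 2 → ℤ) (U : ℂ[X]) :
    Polynomial.aeval (AddMonoidAlgebra.single E (1 : ℂ) : AddMonoidAlgebra ℂ (Fin 2 → ℤ)) U =
      ∑ k ∈ Finset.range (U.natDegree + 1), AddMonoidAlgebra.single (k • E) (U.coeff k) := by
  rw [Polynomial.aeval_eq_sum_range]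
  refine Finset.sum_congr rfl fun k _ => ?_
  rw [AddMonoidAlgebra.single_pow, one_pow, AddMonoidAlgebra.smul_single, smul_eq_mul, mul_one]

/-- Natural multiples of a nonzero vector of `ℤ²` are distinct. [folklore] -/
theorem nsmul_left_injective_of_ne_zero {E : Fin 2 → ℤ} (hE : E ≠ 0) :
    Function.Injective fun k : ℕ => k • E := by
  intro k k' h
  have h' : (k : ℤ) • E = (k' : ℤ) • E := by simpa only [natCast_zsmul] using h
  exact_mod_cast smul_left_injective ℤ hE h'

/-- Coefficients of `U(X^E)` on the ray: `[X^{kE}] U(X^E) = [t^k] U` (`E ≠ 0`). [folklore] -/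
theorem coeff_aeval_single {E : Fin 2 → ℤ} (hE : E ≠ 0) (U : ℂ[X]) (k : ℕ) :
    (Polynomial.aeval (AddMonoidAlgebra.single E (1 : ℂ) : AddMonoidAlgebra ℂ (Fin 2 → ℤ)) U).coeff
      (k • E) = U.coeff k := by
  classical
  rw [aeval_single_eq_sum, AddMonoidAlgebra.coeff_sum, Finset.sum_apply']
  simp only [AddMonoidAlgebra.coeff_single]
  rw [Finset.sum_eq_single k]
  · rw [Finsupp.single_eq_same]
  · intro j _ hjk
    rw [Finsupp.single_eq_of_ne]
    exact fun h => hjk (nsmul_left_injective_of_ne_zero hE h).symm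
  · intro hk
    rw [Finset.mem_range, not_lt] at hk
    rw [Polynomial.coeff_eq_zero_of_natDegree_lt (by omega), Finsupp.single_zero, Finsupp.zero_apply]

/-- Support of `U(X^E)`: the points `k E` with `[t^k] U ≠ 0` (`E ≠ 0`). [folklore] -/
theorem mem_support_aeval_single {E : Fin 2 → ℤ} (hE : E ≠ 0) (U : ℂ[X]) (z : Fin 2 → ℤ) :
    z ∈ (Polynomial.aeval (AddMonoidAlgebra.single E (1 : ℂ) : AddMonoidAlgebra ℂ (Fin 2 → ℤ)) U).coeff.support
      ↔ ∃ k, U.coeff k ≠ 0 ∧ z = k • E := by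
  classical
  constructor
  · intro hz
    rw [aeval_single_eq_sum] at hz
    obtain ⟨k, -, hk⟩ := Finset.mem_biUnion.mp (support_sum_subset _ _ hz)
    rw [AddMonoidAlgebra.coeff_single, Finsupp.mem_support_iff, Finsupp.single_apply] at hk
    have hzk : z = k • E := by
      by_contra h
      rw [if_neg (Ne.symm h)] at hk
      exact hk rfl
    subst hzk
    rw [if_pos rfl] at hk
    exact ⟨k, hk, rfl⟩
  · rintro ⟨k, hk, rfl⟩
    rw [Finsupp.mem_support_iff, coeff_aeval_single hE]
    exact hk

/-- **Initial exponent of a pushed univariate polynomial**: for `U ≠ 0` and a direction `E` of positive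
weight, `U(X^E)` has initial exponent `ord(U) • E` with coefficient the trailing coefficient of `U`.
[folklore] -/
theorem init_aeval_single {E : Fin 2 → ℤ} (hE : 0 < wt w E) {U : ℂ[X]} (hU : U ≠ 0) :
    (Polynomial.aeval (AddMonoidAlgebra.single E (1 : ℂ) : AddMonoidAlgebra ℂ (Fin 2 → ℤ)) U).coeff
        (U.natTrailingDegree • E) = U.trailingCoeff ∧
      U.natTrailingDegree • E ∈
        (Polynomial.aeval (AddMonoidAlgebra.single E (1 : ℂ) : AddMonoidAlgebra ℂ (Fin 2 → ℤ)) U).coeff.support ∧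
      ∀ z ∈ (Polynomial.aeval (AddMonoidAlgebra.single E (1 : ℂ) : AddMonoidAlgebra ℂ (Fin 2 → ℤ)) U).coeff.support,
        wt w (U.natTrailingDegree • E) ≤ wt w z := by
  have hE0 : E ≠ 0 := by
    rintro rfl
    rw [wt_zero] at hE
    exact lt_irrefl _ hE
  have hcoef : (Polynomial.aeval (AddMonoidAlgebra.single E (1 : ℂ) : AddMonoidAlgebra ℂ (Fin 2 → ℤ)) U).coeff
      (U.natTrailingDegree • E) = U.trailingCoeff := coeff_aeval_single hE0 U U.natTrailingDegree
  refine ⟨hcoef, ?_, fun z hz => ?_⟩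
  · rw [Finsupp.mem_support_iff, hcoef]
    exact mt Polynomial.trailingCoeff_eq_zero.mp hU
  · obtain ⟨k, hk, rfl⟩ := (mem_support_aeval_single hE0 U z).mp hz
    rw [wt_nsmul, wt_nsmul]
    exact mul_le_mul_of_nonneg_right (by exact_mod_cast Polynomial.natTrailingDegree_le_of_ne_zero hk) hE.le

/-- A pushed polynomial with constant term `1` has initial exponent `0` and initial coefficient `1`.
[folklore] -/
theorem init_aeval_single_of_coeff_zero {E : Fin 2 → ℤ} (hE : 0 < wt w E) {U : ℂ[X]} (hU : U.coeff 0 = 1) :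
    (Polynomial.aeval (AddMonoidAlgebra.single E (1 : ℂ) : AddMonoidAlgebra ℂ (Fin 2 → ℤ)) U).coeff 0 = 1 ∧
      (0 : Fin 2 → ℤ) ∈
        (Polynomial.aeval (AddMonoidAlgebra.single E (1 : ℂ) : AddMonoidAlgebra ℂ (Fin 2 → ℤ)) U).coeff.support ∧
      ∀ z ∈ (Polynomial.aeval (AddMonoidAlgebra.single E (1 : ℂ) : AddMonoidAlgebra ℂ (Fin 2 → ℤ)) U).coeff.support,
        wt w 0 ≤ wt w z := by
  have hU0 : U ≠ 0 := by
    rintro rfl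
    simp at hU
  have hntd : U.natTrailingDegree = 0 :=
    Polynomial.natTrailingDegree_eq_zero.mpr (Or.inr (by rw [hU]; exact one_ne_zero))
  have h := init_aeval_single hE hU0
  rw [hntd, zero_smul] at h
  refine ⟨?_, h.2.1, h.2.2⟩
  rw [h.1, Polynomial.trailingCoeff, hntd, hU]

/-- Strict monotonicity of the weight along a ray of positive weight. [folklore] -/
theorem wt_nsmul_lt_wt_nsmul {E : Fin 2 → ℤ} (hE : 0 < wt w E) {k k' : ℕ} (h : k < k') :
    wt w (k • E) < wt w (k' • E) := by
  rw [wt_nsmul, wt_nsmul]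
  exact mul_lt_mul_of_pos_right (by exact_mod_cast h) hE

/-- The initial exponent of a negation. [folklore] -/
theorem init_neg {a : AddMonoidAlgebra ℂ (Fin 2 → ℤ)} {x : Fin 2 → ℤ}
    (hx : x ∈ a.coeff.support) (hxmin : ∀ z ∈ a.coeff.support, wt w x ≤ wt w z) :
    x ∈ (-a).coeff.support ∧ ∀ z ∈ (-a).coeff.support, wt w x ≤ wt w z := by
  rw [support_neg]
  exact ⟨hx, hxmin⟩

/-- The initial exponent of a nonzero scalar multiple. [folklore] -/
theorem init_smul {a : AddMonoidAlgebra ℂ (Fin 2 → ℤ)} {x : Fin 2 → ℤ} {c : ℂ} (hc : c ≠ 0)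
    (hx : x ∈ a.coeff.support) (hxmin : ∀ z ∈ a.coeff.support, wt w x ≤ wt w z) :
    (c • a).coeff x = c * a.coeff x ∧ x ∈ (c • a).coeff.support ∧
      ∀ z ∈ (c • a).coeff.support, wt w x ≤ wt w z := by
  rw [support_smul a hc]
  exact ⟨by rw [AddMonoidAlgebra.coeff_smul, Finsupp.smul_apply, smul_eq_mul], hx, hxmin⟩

/-- If `x` is initial for `a` and `y` is initial for `b` with `wt x < wt y`, then `x` is initial for `a + b`.
[folklore] -/
theorem init_add_of_init_lt {a b : AddMonoidAlgebra ℂ (Fin 2 → ℤ)} {x y : Fin 2 → ℤ}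
    (hx : x ∈ a.coeff.support) (hxmin : ∀ z ∈ a.coeff.support, wt w x ≤ wt w z)
    (hymin : ∀ z ∈ b.coeff.support, wt w y ≤ wt w z) (hlt : wt w x < wt w y) :
    (a + b).coeff x = a.coeff x ∧ x ∈ (a + b).coeff.support ∧
      ∀ z ∈ (a + b).coeff.support, wt w x ≤ wt w z :=
  init_add_of_lt hx hxmin fun z hz => hlt.trans_le (hymin z hz)

/-- **Dichotomy for a sum of two elements with distinct initial exponents** (injective weight): the initial
exponent of `a + b` is the initial exponent of `a` or that of `b`. [folklore] -/
theorem init_add_dichotomy (hw : Function.Injective (wt w)) {a b : AddMonoidAlgebra ℂ (Fin 2 → ℤ)}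
    {x y v : Fin 2 → ℤ}
    (hx : x ∈ a.coeff.support) (hxmin : ∀ z ∈ a.coeff.support, wt w x ≤ wt w z)
    (hy : y ∈ b.coeff.support) (hymin : ∀ z ∈ b.coeff.support, wt w y ≤ wt w z) (hxy : x ≠ y)
    (hv : v ∈ (a + b).coeff.support) (hvmin : ∀ z ∈ (a + b).coeff.support, wt w v ≤ wt w z) :
    v = x ∨ v = y := by
  have hne : wt w x ≠ wt w y := fun h => hxy (hw h)
  rcases lt_or_gt_of_ne hne with h | h
  · left
    obtain ⟨-, h1, h2⟩ := init_add_of_init_lt hx hxmin hymin h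
    exact init_unique hw hv hvmin h1 h2
  · right
    obtain ⟨-, h1, h2⟩ := init_add_of_init_lt hy hymin hxmin h
    rw [add_comm] at h1 h2
    exact init_unique hw hv hvmin h1 h2

/-- Registered sub-goal of this toolkit file (siege k6 of `fixedKCoincidence_t2_K3`): the weight of a natural
multiple, `wt w (k • z) = k · wt w z`. [folklore] -/
theorem fixedK3k6_wt_nsmul (w : Fin 2 → ℝ) (k : ℕ) (z : Fin 2 → ℤ) : wt w (k • z) = (k : ℝ) * wt w z :=
  wt_nsmul w k z

end Summit.ValiantsHypothesis.ValiantsHypothesis.Theorems.NewtonUnitEquationsNewtonTauWeak.FixedK3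

end
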